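import Summits.QuantumFields.YangMills.Theorems.FlatTubeReductionDiagonalMomentSandwich
import HarnessLib

/-!
# (L3) AT RATE GRADE, CORE + TAIL form: the moment sandwich on a core `S` of fibre/gauge data plus Gaussian tail masses off `S`
# (route `FlatTubeReduction`, crux K1 `NearFlatRatioLaw` stmt-QuantumFields-24720; seat `ym-line-ftr-p1` g12; rate twin «ratepack-v3 / frozen fibres»; R2b1 RECORD rung — no summit
# statement is proved here)

WHY (memo `Cruxes/NearFlatRatioLaw/Lines/ratepack-v3-frozen-g12.md` §5.5).  `…DiagonalMomentSandwich.fpBOKernel_diag_two_sided_moment` asks for the remainder moment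
`∫ρ₁·∫_d X²e^{|X|}` over ALL fibre/gauge data `p`; off a core (where `β|v|², β|∇g|²` exceed a power `β^{κ}`) the exponent `X` is of size `β` and `e^{|X|}` is not integrable
against the Gaussian tail in any useful sense.  The usable statement splits `p ∈ S` (core: pointwise Haar moment sandwich, moments of `ρ₁` restricted to `S`) from `p ∉ S`
(tail: the masses `∫_{Sᶜ}ρ₁ ≤ η∫ρ₁` and `∫_{Sᶜ}ρ_u ≤ η·f(1)` — Gaussian domination AT `u` and at `1`, a power threshold makes `η` super-polynomially small, no logarithm):
  ★★★ `fpBOKernel_diag_two_sided_moment_core` — `(1 − m₂ − η)·f(1) ≤ f(u) ≤ (1 + m₂ + m_R + η)·f(1)`.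
HONEST FRAMING: Fubini bookkeeping; the moment inputs on the core and the two tail masses are OPEN (two-sided Gaussian domination of the two-slice kernel on the tube, the layer cake of
`…GaussianLayerCake`); femto rung R2b1 (RECORD label); not infinite volume, not a gap, not Clay.  No defs, no named facts, no `sorry`.
-/

set_option autoImplicit false

noncomputable section

open MeasureTheory Filter Topology Real
open scoped BigOperators
open Literature.MathematicalPhysics.QuantumFieldTheory
open Literature.MathematicalPhysics.QuantumLattice

namespace Summit.QuantumFields.YangMills.Theorems.FemtoTransferGap.RateTube

open Summit.QuantumFields.YangMills.Theorems.FemtoTransferGap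
open Summit.QuantumFields.YangMills.Theorems.FemtoTransferGap.TwoLattice
open Summit.QuantumFields.YangMills.Theorems.FemtoTransferGap.TwoLattice.ConstTube
open Summit.QuantumFields.YangMills.Theorems.FemtoTransferGap.TwoLattice.Avg
open Summit.QuantumFields.YangMills.Theorems.FemtoTransferGap.TwoLattice.Cov
open Summit.QuantumFields.YangMills.Theorems.FemtoTransferGap.TwoLattice.Stiff (LinkSpace)

variable {L : ℕ} [NeZero L]

set_option maxHeartbeats 1600000 in
/-- ★★★ **(L3) FROM MOMENTS ON A CORE PLUS TAILS.**  Data as in `fpBOKernel_diag_two_sided_moment`, plus a measurable core `S` of fibre/gauge data `p = (v, v′, g)`.  Hypotheses: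
the pointwise bounds `B p` on the conjugated exponent and its linear part for `p ∈ S`; the CORE moments `∫_S ρ₁·M₂ ≤ m₂∫ρ₁`, `∫_S ρ₁·M_R ≤ m_R∫ρ₁` (`ρ₁ = fpTriple β Ω W 1 1`,
`M₂(p) = ∫_d|X − X₁|`, `M_R(p) = ∫_d X²e^{|X|}`); the TAIL masses `∫_{Sᶜ}ρ₁ ≤ η∫ρ₁` and, for every colour rotation `d`, `∫_{Sᶜ} fpTriple(dud⁻¹, dud⁻¹)/K₁(u,u) ≤ η·f(1)`.
Then `(1 − m₂ − η)·f(1) ≤ f(u) ≤ (1 + m₂ + m_R + η)·f(1)`, `f(u) = fpBOKernel β Ω W u u / K₁^{(L³β)}(u,u)`. [cite: Luscher1983, §3] -/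
theorem fpBOKernel_diag_two_sided_moment_core {β : ℝ} {Ω : LinkSpace L → ℝ} (hΩm : Measurable Ω) {CΩ : ℝ} (hCΩ : ∀ x, |Ω x| ≤ CΩ) (hΩ0 : ∀ x, 0 ≤ Ω x)
    (hΩinv : ∀ (g : SU2) (x : LinkSpace L), Ω (adL L g x) = Ω x) {W : (Site 3 L → SU2) → ℝ} (hW : Measurable W) {CW : ℝ} (hCW : ∀ g, |W g| ≤ CW) (hW0 : ∀ g, 0 ≤ W g)
    (hWinv : ∀ (c : SU2) (g : Site 3 L → SU2), W (fun x => c * g x * c⁻¹) = W g)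
    (u : GaugeConfig 3 1 SU2) {S : Set ((Edge 3 L → Fin 3 → ℝ) × ((Edge 3 L → Fin 3 → ℝ) × (Site 3 L → SU2)))} (hS : MeasurableSet S)
    (B : (Edge 3 L → Fin 3 → ℝ) × ((Edge 3 L → Fin 3 → ℝ) × (Site 3 L → SU2)) → ℝ)
    (hXb : ∀ p ∈ S, ∀ d : SU2, |diagX L β (gaugeTransform (fun _ : Site 3 1 => d) u) p.1 p.2.1 p.2.2| ≤ B p)
    (hX1b : ∀ p ∈ S, ∀ d : SU2, |diagX1 L β (Toron.slowLin (gaugeTransform (fun _ : Site 3 1 => d) u)) p.1 p.2.1 p.2.2| ≤ B p)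
    {m₂ mR η : ℝ}
    (hM₂i : IntegrableOn (fun p : (Edge 3 L → Fin 3 → ℝ) × ((Edge 3 L → Fin 3 → ℝ) × (Site 3 L → SU2)) => fpTriple L β Ω W 1 1 p *
      ∫ d, |diagX L β (gaugeTransform (fun _ : Site 3 1 => d) u) p.1 p.2.1 p.2.2 - diagX1 L β (Toron.slowLin (gaugeTransform (fun _ : Site 3 1 => d) u)) p.1 p.2.1 p.2.2| ∂haarProbability SU2)
      S ((orthoTransverse L).prod ((orthoTransverse L).prod (gaugeMeasure L))))
    (hMRi : IntegrableOn (fun p : (Edge 3 L → Fin 3 → ℝ) × ((Edge 3 L → Fin 3 → ℝ) × (Site 3 L → SU2)) => fpTriple L β Ω W 1 1 p *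
      ∫ d, diagX L β (gaugeTransform (fun _ : Site 3 1 => d) u) p.1 p.2.1 p.2.2 ^ 2 * Real.exp |diagX L β (gaugeTransform (fun _ : Site 3 1 => d) u) p.1 p.2.1 p.2.2| ∂haarProbability SU2)
      S ((orthoTransverse L).prod ((orthoTransverse L).prod (gaugeMeasure L))))
    (hM₂ : ∫ p in S, fpTriple L β Ω W 1 1 p *
        ∫ d, |diagX L β (gaugeTransform (fun _ : Site 3 1 => d) u) p.1 p.2.1 p.2.2 - diagX1 L β (Toron.slowLin (gaugeTransform (fun _ : Site 3 1 => d) u)) p.1 p.2.1 p.2.2| ∂haarProbability SU2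
        ∂((orthoTransverse L).prod ((orthoTransverse L).prod (gaugeMeasure L))) ≤
      m₂ * ∫ p, fpTriple L β Ω W 1 1 p ∂((orthoTransverse L).prod ((orthoTransverse L).prod (gaugeMeasure L))))
    (hMR : ∫ p in S, fpTriple L β Ω W 1 1 p *
        ∫ d, diagX L β (gaugeTransform (fun _ : Site 3 1 => d) u) p.1 p.2.1 p.2.2 ^ 2 * Real.exp |diagX L β (gaugeTransform (fun _ : Site 3 1 => d) u) p.1 p.2.1 p.2.2| ∂haarProbability SU2
        ∂((orthoTransverse L).prod ((orthoTransverse L).prod (gaugeMeasure L))) ≤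
      mR * ∫ p, fpTriple L β Ω W 1 1 p ∂((orthoTransverse L).prod ((orthoTransverse L).prod (gaugeMeasure L))))
    (htail1 : ∫ p in Sᶜ, fpTriple L β Ω W 1 1 p ∂((orthoTransverse L).prod ((orthoTransverse L).prod (gaugeMeasure L))) ≤
      η * ∫ p, fpTriple L β Ω W 1 1 p ∂((orthoTransverse L).prod ((orthoTransverse L).prod (gaugeMeasure L))))
    (htailu : ∀ d : SU2, (∫ p in Sᶜ, fpTriple L β Ω W (gaugeTransform (fun _ : Site 3 1 => d) u) (gaugeTransform (fun _ : Site 3 1 => d) u) p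
        ∂((orthoTransverse L).prod ((orthoTransverse L).prod (gaugeMeasure L)))) / transferKernel su2Rep ((L : ℝ) ^ 3 * β) u u ≤
      η * ((∫ p, fpTriple L β Ω W 1 1 p ∂((orthoTransverse L).prod ((orthoTransverse L).prod (gaugeMeasure L)))) /
        transferKernel su2Rep ((L : ℝ) ^ 3 * β) (1 : GaugeConfig 3 1 SU2) 1)) :
    (1 - m₂ - η) * (fpBOKernel L β Ω W 1 1 / transferKernel su2Rep ((L : ℝ) ^ 3 * β) (1 : GaugeConfig 3 1 SU2) 1) ≤
        fpBOKernel L β Ω W u u / transferKernel su2Rep ((L : ℝ) ^ 3 * β) u u ∧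
      fpBOKernel L β Ω W u u / transferKernel su2Rep ((L : ℝ) ^ 3 * β) u u ≤
        (1 + m₂ + mR + η) * (fpBOKernel L β Ω W 1 1 / transferKernel su2Rep ((L : ℝ) ^ 3 * β) (1 : GaugeConfig 3 1 SU2) 1) := by
  haveI := isFiniteMeasure_orthoTransverse L
  haveI : SecondCountableTopology SU2 := secondCountableTopology_su2
  set μP : Measure ((Edge 3 L → Fin 3 → ℝ) × ((Edge 3 L → Fin 3 → ℝ) × (Site 3 L → SU2))) := (orthoTransverse L).prod ((orthoTransverse L).prod (gaugeMeasure L)) with hμP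
  haveI : IsFiniteMeasure μP := by rw [hμP]; infer_instance
  set K1 : ℝ := transferKernel su2Rep ((L : ℝ) ^ 3 * β) (1 : GaugeConfig 3 1 SU2) 1 with hK1
  set Ku : ℝ := transferKernel su2Rep ((L : ℝ) ^ 3 * β) u u with hKu
  have hK1p : 0 < K1 := transferKernel_pos _ _ _ _
  have hKup : 0 < Ku := transferKernel_pos _ _ _ _
  -- abbreviations for the exponent and the two Haar moments
  set X : SU2 → ((Edge 3 L → Fin 3 → ℝ) × ((Edge 3 L → Fin 3 → ℝ) × (Site 3 L → SU2))) → ℝ :=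
    fun d p => diagX L β (gaugeTransform (fun _ : Site 3 1 => d) u) p.1 p.2.1 p.2.2 with hXdef
  set M₂ : ((Edge 3 L → Fin 3 → ℝ) × ((Edge 3 L → Fin 3 → ℝ) × (Site 3 L → SU2))) → ℝ :=
    fun p => ∫ d, |diagX L β (gaugeTransform (fun _ : Site 3 1 => d) u) p.1 p.2.1 p.2.2 - diagX1 L β (Toron.slowLin (gaugeTransform (fun _ : Site 3 1 => d) u)) p.1 p.2.1 p.2.2| ∂haarProbability SU2
    with hM₂def
  set MR : ((Edge 3 L → Fin 3 → ℝ) × ((Edge 3 L → Fin 3 → ℝ) × (Site 3 L → SU2))) → ℝ :=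
    fun p => ∫ d, diagX L β (gaugeTransform (fun _ : Site 3 1 => d) u) p.1 p.2.1 p.2.2 ^ 2 * Real.exp |diagX L β (gaugeTransform (fun _ : Site 3 1 => d) u) p.1 p.2.1 p.2.2| ∂haarProbability SU2
    with hMRdef
  -- the reference density `ρ = fpTriple(1,1)/K1 ≥ 0`
  set ρ : ((Edge 3 L → Fin 3 → ℝ) × ((Edge 3 L → Fin 3 → ℝ) × (Site 3 L → SU2))) → ℝ := fun p => fpTriple L β Ω W 1 1 p / K1 with hρ
  obtain ⟨Bρ, hBρ⟩ := abs_fpTriple_le (L := L) β hCΩ hCW (1 : GaugeConfig 3 1 SU2) 1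
  have hρm : Measurable ρ := (measurable_fpTriple β hΩm hW 1 1).div_const _
  have hρ0 : ∀ p, 0 ≤ ρ p := fun p => by
    rw [hρ]; dsimp only; unfold fpTriple
    exact div_nonneg (mul_nonneg (hΩ0 _) (mul_nonneg (mul_nonneg (hW0 _) (transferKernel_pos _ _ _ _).le) (hΩ0 _))) hK1p.le
  have hρb : ∀ p, |ρ p| ≤ Bρ / K1 := fun p => by rw [hρ]; dsimp only; rw [abs_div, abs_of_pos hK1p]; exact div_le_div_of_nonneg_right (hBρ p) hK1p.le
  have hρint : Integrable ρ μP := integrable_of_measurable_abs_le _ hρm hρb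
  -- f(1) = ∫ ρ
  have hf1 : fpBOKernel L β Ω W 1 1 / K1 = ∫ p, ρ p ∂μP := by
    rw [hρ, integral_div, hμP, ← fpBOKernel_eq_integral_prod β hΩm hCΩ hW hCW]
  -- f(u) = ∫_d ∫_p ρ·exp(X d p)
  have hfu_conj : ∀ d : SU2, fpBOKernel L β Ω W (gaugeTransform (fun _ : Site 3 1 => d) u) (gaugeTransform (fun _ : Site 3 1 => d) u) / Ku =
      ∫ p, ρ p * Real.exp (X d p) ∂μP := fun d => by
    rw [hμP, fpBOKernel_eq_integral_prod β hΩm hCΩ hW hCW, ← integral_div]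
    refine integral_congr_ae (ae_of_all _ fun p => ?_)
    dsimp only
    rw [hKu, fpTriple_conj_div_eq, hρ]
  have hfu : fpBOKernel L β Ω W u u / Ku = ∫ d, ∫ p, ρ p * Real.exp (X d p) ∂μP ∂haarProbability SU2 := by
    have hconst : ∀ d : SU2, fpBOKernel L β Ω W (gaugeTransform (fun _ : Site 3 1 => d) u) (gaugeTransform (fun _ : Site 3 1 => d) u) / Ku = fpBOKernel L β Ω W u u / Ku :=
      fun d => by rw [fpBOKernel_conj β hΩm hΩinv hW hWinv d u u]
    simp_rw [← hfu_conj, hconst]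
    simp
  -- the joint integrand and Fubini (as in the sup version: `G` is uniformly bounded)
  set G : SU2 × ((Edge 3 L → Fin 3 → ℝ) × ((Edge 3 L → Fin 3 → ℝ) × (Site 3 L → SU2))) → ℝ := fun q => ρ q.2 * Real.exp (X q.1 q.2) with hG
  have hGeq : ∀ q : SU2 × ((Edge 3 L → Fin 3 → ℝ) × ((Edge 3 L → Fin 3 → ℝ) × (Site 3 L → SU2))),
      G q = fpTriple L β Ω W (gaugeTransform (fun _ : Site 3 1 => q.1) u) (gaugeTransform (fun _ : Site 3 1 => q.1) u) q.2 / Ku := fun q => by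
    rw [hG]; dsimp only; rw [hKu, fpTriple_conj_div_eq, hρ]
  have hGm : Measurable G := by
    have hfun : G = fun q : SU2 × ((Edge 3 L → Fin 3 → ℝ) × ((Edge 3 L → Fin 3 → ℝ) × (Site 3 L → SU2))) =>
        fpTriple L β Ω W (gaugeTransform (fun _ : Site 3 1 => q.1) u) (gaugeTransform (fun _ : Site 3 1 => q.1) u) q.2 / Ku := funext hGeq
    rw [hfun]
    refine Measurable.div_const ?_ _
    have hK : Measurable fun r : GaugeConfig 3 L SU2 × GaugeConfig 3 L SU2 => transferKernel su2Rep β r.1 r.2 :=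
      (continuous_transferKernel su2Rep continuous_su2Rep β).measurable
    have hc : Measurable fun q : SU2 × ((Edge 3 L → Fin 3 → ℝ) × ((Edge 3 L → Fin 3 → ℝ) × (Site 3 L → SU2))) => gaugeTransform (fun _ : Site 3 1 => q.1) u :=
      (measurable_constGaugeAction_left (L := 1) u).comp measurable_fst
    have hU : Measurable fun q : SU2 × ((Edge 3 L → Fin 3 → ℝ) × ((Edge 3 L → Fin 3 → ℝ) × (Site 3 L → SU2))) =>
        orthoTube L (gaugeTransform (fun _ : Site 3 1 => q.1) u) q.2.1 := by
      have h := (measurable_orthoTube L).comp (hc.prodMk (measurable_fst.comp measurable_snd))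
      simpa only [Function.comp_def] using h
    have hV : Measurable fun q : SU2 × ((Edge 3 L → Fin 3 → ℝ) × ((Edge 3 L → Fin 3 → ℝ) × (Site 3 L → SU2))) =>
        gaugeTransform q.2.2.2 (orthoTube L (gaugeTransform (fun _ : Site 3 1 => q.1) u) q.2.2.1) := by
      have h1 : Measurable fun q : SU2 × ((Edge 3 L → Fin 3 → ℝ) × ((Edge 3 L → Fin 3 → ℝ) × (Site 3 L → SU2))) =>
          orthoTube L (gaugeTransform (fun _ : Site 3 1 => q.1) u) q.2.2.1 := by
        have h := (measurable_orthoTube L).comp (hc.prodMk (measurable_fst.comp (measurable_snd.comp measurable_snd)))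
        simpa only [Function.comp_def] using h
      have h := (measurable_gaugeAction (L := L)).comp (h1.prodMk (measurable_snd.comp (measurable_snd.comp measurable_snd)))
      simpa only [Function.comp_def] using h
    have hKq : Measurable fun q : SU2 × ((Edge 3 L → Fin 3 → ℝ) × ((Edge 3 L → Fin 3 → ℝ) × (Site 3 L → SU2))) =>
        transferKernel su2Rep β (orthoTube L (gaugeTransform (fun _ : Site 3 1 => q.1) u) q.2.1)
          (gaugeTransform q.2.2.2 (orthoTube L (gaugeTransform (fun _ : Site 3 1 => q.1) u) q.2.2.1)) := by
      have h := hK.comp (hU.prodMk hV); simpa only [Function.comp_def] using h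
    unfold fpTriple
    exact (hΩm.comp ((measurable_linkEmbed L).comp (measurable_fst.comp measurable_snd))).mul
      (((hW.comp (measurable_snd.comp (measurable_snd.comp measurable_snd))).mul hKq).mul
        (hΩm.comp ((measurable_linkEmbed L).comp (measurable_fst.comp (measurable_snd.comp measurable_snd)))))
  obtain ⟨M, hM⟩ := exists_transferKernel_le su2Rep continuous_su2Rep β (L := L)
  have hCΩ0 : 0 ≤ CΩ := (abs_nonneg _).trans (hCΩ 0)
  have hCW0 : 0 ≤ CW := (abs_nonneg _).trans (hCW 1)
  have hM0 : 0 ≤ M := (transferKernel_pos su2Rep β (1 : GaugeConfig 3 L SU2) 1).le.trans (hM 1 1)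
  have habs : ∀ (w w' : GaugeConfig 3 1 SU2) (q : (Edge 3 L → Fin 3 → ℝ) × ((Edge 3 L → Fin 3 → ℝ) × (Site 3 L → SU2))), |fpTriple L β Ω W w w' q| ≤ CΩ * ((CW * M) * CΩ) :=
    fun w w' q => by
      unfold fpTriple
      rw [abs_mul, abs_mul, abs_mul, abs_of_pos (transferKernel_pos su2Rep β _ _)]
      exact mul_le_mul (hCΩ _) (mul_le_mul (mul_le_mul (hCW _) (hM _ _) (transferKernel_pos su2Rep β _ _).le hCW0) (hCΩ _) (abs_nonneg _) (mul_nonneg hCW0 hM0))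
        (mul_nonneg (mul_nonneg (abs_nonneg _) (transferKernel_pos su2Rep β _ _).le) (abs_nonneg _)) hCΩ0
  have hGb : ∀ q, |G q| ≤ CΩ * ((CW * M) * CΩ) / Ku := fun q => by
    rw [hGeq, abs_div, abs_of_pos hKup]; exact div_le_div_of_nonneg_right (habs _ _ _) hKup.le
  have hGint : Integrable G ((haarProbability SU2).prod μP) := integrable_of_measurable_abs_le _ hGm hGb
  have hswap0 : ∫ d, ∫ p, ρ p * Real.exp (X d p) ∂μP ∂haarProbability SU2 = ∫ d, ∫ p, G (d, p) ∂μP ∂haarProbability SU2 := by rw [hG]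
  -- nonnegativity of `G`
  have hG0 : ∀ q, 0 ≤ G q := fun q => by rw [hG]; exact mul_nonneg (hρ0 _) (Real.exp_pos _).le
  -- the restricted measures and Fubini on them
  set μS : Measure ((Edge 3 L → Fin 3 → ℝ) × ((Edge 3 L → Fin 3 → ℝ) × (Site 3 L → SU2))) := μP.restrict S with hμS
  set μT : Measure ((Edge 3 L → Fin 3 → ℝ) × ((Edge 3 L → Fin 3 → ℝ) × (Site 3 L → SU2))) := μP.restrict Sᶜ with hμT
  have hGintS : Integrable G ((haarProbability SU2).prod μS) := hGint.mono_measure (Measure.prod_mono le_rfl Measure.restrict_le_self)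
  have hGintT : Integrable G ((haarProbability SU2).prod μT) := hGint.mono_measure (Measure.prod_mono le_rfl Measure.restrict_le_self)
  have hGsec : ∀ d : SU2, Integrable (fun p => G (d, p)) μP := fun d =>
    integrable_of_measurable_abs_le _ (hGm.comp measurable_prodMk_left) fun p => hGb (d, p)
  have hsplit : ∀ d : SU2, ∫ p, G (d, p) ∂μP = ∫ p in S, G (d, p) ∂μP + ∫ p in Sᶜ, G (d, p) ∂μP := fun d => (integral_add_compl hS (hGsec d)).symm
  have hIS : Integrable (fun d => ∫ p in S, G (d, p) ∂μP) (haarProbability SU2) := hGintS.integral_prod_left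
  have hIT : Integrable (fun d => ∫ p in Sᶜ, G (d, p) ∂μP) (haarProbability SU2) := hGintT.integral_prod_left
  have hfu' : fpBOKernel L β Ω W u u / Ku = ∫ d, ∫ p in S, G (d, p) ∂μP ∂haarProbability SU2 + ∫ d, ∫ p in Sᶜ, G (d, p) ∂μP ∂haarProbability SU2 := by
    rw [hfu, hswap0, ← integral_add hIS hIT]
    exact integral_congr_ae (ae_of_all _ fun d => hsplit d)
  have hswapS : ∫ d, ∫ p in S, G (d, p) ∂μP ∂haarProbability SU2 = ∫ p in S, ∫ d, G (d, p) ∂haarProbability SU2 ∂μP := by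
    have h := integral_integral_swap (f := fun d p => G (d, p)) hGintS
    simpa only using h
  have hinnerS : Integrable (fun p => ∫ d, G (d, p) ∂haarProbability SU2) μS := hGintS.swap.integral_prod_left
  -- the pointwise MOMENT sandwich on the core
  have hpt : ∀ p ∈ S, (1 - M₂ p) * ρ p ≤ ∫ d, G (d, p) ∂haarProbability SU2 ∧ ∫ d, G (d, p) ∂haarProbability SU2 ≤ (1 + M₂ p + MR p) * ρ p := by
    intro p hp
    have hI : ∫ d, G (d, p) ∂haarProbability SU2 = ρ p * ∫ d, Real.exp (X d p) ∂haarProbability SU2 := by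
      rw [hG]; dsimp only; rw [integral_const_mul]
    rw [hI]
    have hsand := haar_integral_exp_diagX_moment (L := L) β u p.1 p.2.1 p.2.2 (hXb p hp) (hX1b p hp)
    have hρp0 : 0 ≤ ρ p := hρ0 p
    constructor
    · calc (1 - M₂ p) * ρ p = ρ p * (1 - M₂ p) := mul_comm _ _
        _ ≤ ρ p * ∫ d, Real.exp (X d p) ∂haarProbability SU2 := mul_le_mul_of_nonneg_left (by rw [hM₂def]; exact hsand.1) hρp0
    · calc ρ p * ∫ d, Real.exp (X d p) ∂haarProbability SU2 ≤ ρ p * (1 + M₂ p + MR p) := mul_le_mul_of_nonneg_left (by rw [hM₂def, hMRdef]; exact hsand.2) hρp0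
        _ = (1 + M₂ p + MR p) * ρ p := mul_comm _ _
  -- the hypotheses in `ρ`-currency
  have e2 : ∫ p, ρ p ∂μP = (∫ p, fpTriple L β Ω W 1 1 p ∂μP) / K1 := by rw [hρ, integral_div]
  have hM₂i' : IntegrableOn (fun p => ρ p * M₂ p) S μP := by
    have h := hM₂i.div_const K1
    refine h.congr (ae_of_all _ fun p => ?_)
    dsimp only; rw [hρ]; dsimp only; rw [hM₂def]; ring
  have hMRi' : IntegrableOn (fun p => ρ p * MR p) S μP := by
    have h := hMRi.div_const K1
    refine h.congr (ae_of_all _ fun p => ?_)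
    dsimp only; rw [hρ]; dsimp only; rw [hMRdef]; ring
  have hM₂' : ∫ p in S, ρ p * M₂ p ∂μP ≤ m₂ * ∫ p, ρ p ∂μP := by
    have e1 : ∫ p in S, ρ p * M₂ p ∂μP = (∫ p in S, fpTriple L β Ω W 1 1 p * M₂ p ∂μP) / K1 := by
      rw [← integral_div]; refine integral_congr_ae (ae_of_all _ fun p => ?_); dsimp only; rw [hρ]; dsimp only; ring
    rw [e1, e2, ← mul_div_assoc]
    exact div_le_div_of_nonneg_right (by rw [hM₂def, hμP]; exact hM₂) hK1p.le
  have hMR' : ∫ p in S, ρ p * MR p ∂μP ≤ mR * ∫ p, ρ p ∂μP := by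
    have e1 : ∫ p in S, ρ p * MR p ∂μP = (∫ p in S, fpTriple L β Ω W 1 1 p * MR p ∂μP) / K1 := by
      rw [← integral_div]; refine integral_congr_ae (ae_of_all _ fun p => ?_); dsimp only; rw [hρ]; dsimp only; ring
    rw [e1, e2, ← mul_div_assoc]
    exact div_le_div_of_nonneg_right (by rw [hMRdef, hμP]; exact hMR) hK1p.le
  have htail1' : ∫ p in Sᶜ, ρ p ∂μP ≤ η * ∫ p, ρ p ∂μP := by
    have e1 : ∫ p in Sᶜ, ρ p ∂μP = (∫ p in Sᶜ, fpTriple L β Ω W 1 1 p ∂μP) / K1 := by rw [hρ, integral_div]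
    rw [e1, e2, ← mul_div_assoc]
    exact div_le_div_of_nonneg_right (by rw [hμP]; exact htail1) hK1p.le
  have hρS : ∫ p in S, ρ p ∂μP = ∫ p, ρ p ∂μP - ∫ p in Sᶜ, ρ p ∂μP := by
    have h := integral_add_compl hS hρint
    linarith
  have hρT0 : 0 ≤ ∫ p in Sᶜ, ρ p ∂μP := setIntegral_nonneg hS.compl fun p _ => hρ0 p
  -- the tail at `u`: `0 ≤ ∫_d ∫_{Sᶜ} G ≤ η ∫ρ`
  have htailG : ∀ d : SU2, ∫ p in Sᶜ, G (d, p) ∂μP ≤ η * ∫ p, ρ p ∂μP := fun d => by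
    have e1 : ∫ p in Sᶜ, G (d, p) ∂μP = (∫ p in Sᶜ, fpTriple L β Ω W (gaugeTransform (fun _ : Site 3 1 => d) u) (gaugeTransform (fun _ : Site 3 1 => d) u) p ∂μP) / Ku := by
      rw [← integral_div]; exact integral_congr_ae (ae_of_all _ fun p => hGeq (d, p))
    rw [e1, e2, hμP]
    exact htailu d
  have hT_up : ∫ d, ∫ p in Sᶜ, G (d, p) ∂μP ∂haarProbability SU2 ≤ η * ∫ p, ρ p ∂μP := by
    have h := integral_mono hIT (integrable_const (η * ∫ p, ρ p ∂μP)) htailG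
    simpa using h
  have hT_low : 0 ≤ ∫ d, ∫ p in Sᶜ, G (d, p) ∂μP ∂haarProbability SU2 :=
    integral_nonneg fun d => setIntegral_nonneg hS.compl fun p _ => hG0 (d, p)
  -- the core
  have hlowS : IntegrableOn (fun p => (1 - M₂ p) * ρ p) S μP := by
    have h : IntegrableOn (fun p => ρ p - ρ p * M₂ p) S μP := hρint.integrableOn.sub hM₂i'
    refine h.congr (ae_of_all _ fun p => ?_); dsimp only; ring
  have hupS : IntegrableOn (fun p => (1 + M₂ p + MR p) * ρ p) S μP := by
    have h : IntegrableOn (fun p => (ρ p + ρ p * M₂ p) + ρ p * MR p) S μP := (hρint.integrableOn.add hM₂i').add hMRi'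
    refine h.congr (ae_of_all _ fun p => ?_); dsimp only; ring
  have hC_low : ∫ p in S, ρ p ∂μP - ∫ p in S, ρ p * M₂ p ∂μP ≤ ∫ p in S, ∫ d, G (d, p) ∂haarProbability SU2 ∂μP := by
    calc ∫ p in S, ρ p ∂μP - ∫ p in S, ρ p * M₂ p ∂μP = ∫ p in S, (1 - M₂ p) * ρ p ∂μP := by
          rw [← integral_sub hρint.integrableOn hM₂i']; refine integral_congr_ae (ae_of_all _ fun p => ?_); dsimp only; ring
      _ ≤ ∫ p in S, ∫ d, G (d, p) ∂haarProbability SU2 ∂μP := setIntegral_mono_on hlowS hinnerS hS fun p hp => (hpt p hp).1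
  have hC_up : ∫ p in S, ∫ d, G (d, p) ∂haarProbability SU2 ∂μP ≤ ∫ p in S, ρ p ∂μP + ∫ p in S, ρ p * M₂ p ∂μP + ∫ p in S, ρ p * MR p ∂μP := by
    have hI1 : IntegrableOn (fun p => ρ p + ρ p * M₂ p) S μP := hρint.integrableOn.add hM₂i'
    calc ∫ p in S, ∫ d, G (d, p) ∂haarProbability SU2 ∂μP ≤ ∫ p in S, (1 + M₂ p + MR p) * ρ p ∂μP := setIntegral_mono_on hinnerS hupS hS fun p hp => (hpt p hp).2
      _ = ∫ p in S, ((ρ p + ρ p * M₂ p) + ρ p * MR p) ∂μP := integral_congr_ae (ae_of_all _ fun p => by dsimp only; ring)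
      _ = ∫ p in S, ρ p ∂μP + ∫ p in S, ρ p * M₂ p ∂μP + ∫ p in S, ρ p * MR p ∂μP := by rw [integral_add hI1 hMRi', integral_add hρint.integrableOn hM₂i']
  have hSM₂0 : 0 ≤ ∫ p in S, ρ p * M₂ p ∂μP := setIntegral_nonneg hS fun p _ => mul_nonneg (hρ0 p) (by
    rw [hM₂def]; exact integral_nonneg fun d => abs_nonneg _)
  -- assemble
  rw [hfu', hswapS, hf1]
  constructor
  · nlinarith [hC_low, hT_low, hM₂', htail1', hρS]
  · nlinarith [hC_up, hT_up, hM₂', hMR', htail1', hρS, hρT0]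

end Summit.QuantumFields.YangMills.Theorems.FemtoTransferGap.RateTube

end
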